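import Summits.Ventures.Crystal3D.Theorems.StickyWulffConstantGenericWallFloorPlateSlide
import Summits.Ventures.Crystal3D.Theorems.StickyWulffConstantGenericWallFloorTubeWalkSF
import HarnessLib

/-!
# The refusal walk: a coherent walk in a tilted tube that never enters the terminal class

HONEST FRAMING. Venture `Summits/Ventures/Crystal3D` (cell `crystal3d-full`), helper for the crux
`GenericWallFloor` (stmt-Ventures-19480) of `route-Ventures-StickyWulffConstant`, REGISTERED line `WallLedgerG`,
open stub `stub_twoSlabAdhesion` (general fillings; the `Σ3ⁿ` chain pairs).  Rung credit only; F-C1 not moved.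

`refusal_walk_pays`: ARCH v4's steered coherent walk, run in a TILTED tube whose unit axis direction `z` lies in
the plane of the unique terminal twin family `± m` of the pair (…TwinTreeTerminal) and rises at rate
`⟪z, e₃⟫ ≥ σ > 0`.  Frames are kept in an ADMISSIBLE class `𝓐` (disjoint from the terminal class `𝓣 ∋` every
frame of lattice `A₂(Λ₀)`), whose `{111}` mirrors either stay in `𝓐` or land in `𝓣` with normal `± m`.  Steps:
`walk_moves`; a payer within contact distance ends the walk; fcc / non-terminal twin steps are steered by
`exists_steering_slot` / `exists_steering_twinDozen` (rise `≥ 1/32` along `z`, inward when the lateral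
deviation `r(y) = (y − a) − ⟪y − a, z⟫ z` has norm `≥ 16`; `‖r‖² ≤ 289` is preserved); a TERMINAL twin step is
REFUSED: the walk slides up the plate (`twinDozen_plateSlide_payer`) and pays there.  A state of `𝓐` deep in
the top window is impossible (`movedFcc_eq_of_exact_neighbours_top_sf`).  Output: an unsaturated ball within
lateral distance `20` of the axis at height in `[a₂ − 21, h + R₀ + 4)` — the SAME tube, whence injective
counting and an `h`-free charge (next file).
WHAT THIS IS NOT: not the stub; no counting; F-C1 not moved.
-/

noncomputable section

namespace Summit.Ventures.Crystal3D.Theorems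

open Summit.Ventures.Crystal3D Finset
open Literature.MathematicalPhysics.StatisticalMechanics (fccStacking)
open scoped InnerProductSpace

/-- The tube is kept: vector form of `horiz_step_le`. -/
theorem perp_step_le {r d z : EuclideanSpace ℝ (Fin 3)} (hz : ‖z‖ = 1) (hrz : ⟪r, z⟫_ℝ = 0)
    (hr : ‖r‖ ^ 2 ≤ 289) (hd : ‖d‖ = 1) (hsteer : (16 : ℝ) ^ 2 ≤ ‖r‖ ^ 2 → ⟪r, d⟫_ℝ ≤ -(1 / 2)) :
    ‖r + (d - ⟪d, z⟫_ℝ • z)‖ ^ 2 ≤ 289 := by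
  have hperp : ‖d - ⟪d, z⟫_ℝ • z‖ ^ 2 ≤ 1 := by
    rw [norm_sq_perp_step hd hz]; linarith [sq_nonneg ⟪d, z⟫_ℝ]
  have hinner : ⟪r, d - ⟪d, z⟫_ℝ • z⟫_ℝ = ⟪r, d⟫_ℝ := by
    rw [inner_sub_right, real_inner_smul_right, hrz, mul_zero, sub_zero]
  rw [norm_add_sq_real, hinner]
  by_cases hs : (16 : ℝ) ^ 2 ≤ ‖r‖ ^ 2
  · have := hsteer hs; linarith
  · push Not at hs
    have hr16 : ‖r‖ < 16 := by nlinarith [norm_nonneg r]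
    have hcs : ⟪r, d⟫_ℝ ≤ ‖r‖ := by
      have := real_inner_le_norm r d; rw [hd, mul_one] at this; exact this
    nlinarith [norm_nonneg r]

/-- The refusal walk statement is long; see the module docstring. -/
theorem refusal_walk_pays {δ : ℝ} (hg : KissingGap δ) (hc : KissingClassification δ)
    (X : Finset (EuclideanSpace ℝ (Fin 3))) (hX : ∀ p ∈ X, ∀ q ∈ X, p ≠ q → 1 ≤ dist p q)
    (A₂ : EuclideanSpace ℝ (Fin 3) ≃ₗᵢ[ℝ] EuclideanSpace ℝ (Fin 3)) (t₂ : EuclideanSpace ℝ (Fin 3))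
    (P₂ : Finset (EuclideanSpace ℝ (Fin 3))) (R₀ h ρ : ℝ) (hR₀ : 3 ≤ R₀) (hρ : R₀ ≤ ρ)
    (hP₂X : P₂ ⊆ X) (hcell : ∀ p ∈ X, p 2 ≤ h + 2 * R₀)
    (hP₂ : ∀ p, p ∈ P₂ ↔ (p ∈ (fun q => A₂ q + t₂) '' fccStacking 1 (Real.sqrt (2 / 3)) ∧
      h + R₀ ≤ p 2 ∧ p 2 ≤ h + 2 * R₀ ∧ p 0 ^ 2 + p 1 ^ 2 ≤ ρ ^ 2))
    (𝓣 : Set (EuclideanSpace ℝ (Fin 3) ≃ₗᵢ[ℝ] EuclideanSpace ℝ (Fin 3)))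
    (hT : ∀ G : EuclideanSpace ℝ (Fin 3) ≃ₗᵢ[ℝ] EuclideanSpace ℝ (Fin 3),
      G '' fccStacking 1 (Real.sqrt (2 / 3)) = A₂ '' fccStacking 1 (Real.sqrt (2 / 3)) → G ∈ 𝓣)
    (𝓐 : Set (EuclideanSpace ℝ (Fin 3) ≃ₗᵢ[ℝ] EuclideanSpace ℝ (Fin 3))) (h𝓐 : ∀ F ∈ 𝓐, F ∉ 𝓣)
    {m : EuclideanSpace ℝ (Fin 3)} (hm : ‖m‖ = 1)
    (hmir : ∀ F ∈ 𝓐, ∀ n : EuclideanSpace ℝ (Fin 3), ‖n‖ = 1 →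
      (∀ w ∈ fccSlots, ⟪F w, n⟫_ℝ = 0 ∨ ⟪F w, n⟫_ℝ = Real.sqrt (2 / 3) ∨ ⟪F w, n⟫_ℝ = -Real.sqrt (2 / 3)) →
      ∀ F' : EuclideanSpace ℝ (Fin 3) ≃ₗᵢ[ℝ] EuclideanSpace ℝ (Fin 3), (∀ x, F' x = F x - (2 * ⟪F x, n⟫_ℝ) • n) →
        (F' ∉ 𝓣 → F' ∈ 𝓐) ∧ (F' ∈ 𝓣 → n = m ∨ n = -m))
    {z : EuclideanSpace ℝ (Fin 3)} (hz : ‖z‖ = 1) (hzm : ⟪z, m⟫_ℝ = 0)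
    {σ : ℝ} (hσ : 0 < σ) (hσz : σ ≤ ⟪z, EuclideanSpace.single (2 : Fin 3) (1 : ℝ)⟫_ℝ)
    (he₃ : EuclideanSpace.single (2 : Fin 3) (1 : ℝ) =
      ⟪EuclideanSpace.single (2 : Fin 3) (1 : ℝ), z⟫_ℝ • z + ⟪EuclideanSpace.single (2 : Fin 3) (1 : ℝ), m⟫_ℝ • m)
    (a : EuclideanSpace ℝ (Fin 3))
    (hlat : ∀ y ∈ X, ‖y - a - ⟪y - a, z⟫_ℝ • z‖ ≤ 20 → h + R₀ + 2 ≤ y 2 → y 0 ^ 2 + y 1 ^ 2 ≤ (ρ - 2) ^ 2) :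
    ∀ (k : ℕ) (y : EuclideanSpace ℝ (Fin 3)) (F : EuclideanSpace ℝ (Fin 3) ≃ₗᵢ[ℝ] EuclideanSpace ℝ (Fin 3))
      (b₁ b₂ b₃ : EuclideanSpace ℝ (Fin 3)), y ∈ X → F ∈ 𝓐 → b₁ ∈ fccSlots → b₂ ∈ fccSlots → b₃ ∈ fccSlots →
      LinearIndependent ℝ ![b₁, b₂, b₃] → y + F b₁ ∈ X → y + F b₂ ∈ X → y + F b₃ ∈ X →
      ‖y - a - ⟪y - a, z⟫_ℝ • z‖ ^ 2 ≤ 289 → 0 ≤ ⟪y - a, z⟫_ℝ → y 2 < h + R₀ + 2 →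
      ((h + 2 * R₀ + 20 - a 2) / σ - ⟪y - a, z⟫_ℝ) * 32 ≤ k →
      ∃ q ∈ X, (X.filter fun y' => dist q y' = 1).card ≠ 12 ∧ ‖q - a - ⟪q - a, z⟫_ℝ • z‖ ≤ 20 ∧
        a 2 - 21 ≤ q 2 ∧ q 2 < h + R₀ + 4 := by
  set e₃ : EuclideanSpace ℝ (Fin 3) := EuclideanSpace.single (2 : Fin 3) (1 : ℝ) with he₃def
  have he₃n : ‖e₃‖ = 1 := by rw [he₃def, PiLp.norm_single, norm_one]
  set r : EuclideanSpace ℝ (Fin 3) → EuclideanSpace ℝ (Fin 3) := fun y => y - a - ⟪y - a, z⟫_ℝ • z with hrdef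
  have hr_apply : ∀ y, r y = y - a - ⟪y - a, z⟫_ℝ • z := fun y => rfl
  have hrz : ∀ y, ⟪r y, z⟫_ℝ = 0 := fun y => inner_lateral_axis y a z hz
  have hr_add : ∀ y d, r (y + d) = r y + (d - ⟪d, z⟫_ℝ • z) := fun y d => lateral_dev_add y a z d
  have hme₃ : |⟪m, e₃⟫_ℝ| ≤ 1 := by
    have := abs_real_inner_le_norm m e₃; rwa [hm, he₃n, one_mul] at this
  have hze₃pos : 0 < ⟪z, e₃⟫_ℝ := lt_of_lt_of_le hσ hσz
  have height : ∀ y, y 2 = a 2 + ⟪y - a, z⟫_ℝ * ⟪z, e₃⟫_ℝ + ⟪r y, m⟫_ℝ * ⟪m, e₃⟫_ℝ := by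
    intro y
    rw [real_inner_comm e₃ z, real_inner_comm e₃ m]
    exact height_eq_of_axis y a z m hzm he₃
  set S : ℝ := (h + 2 * R₀ + 20 - a 2) / σ with hS
  -- a payer at distance `≤ 1` from a tube ball is a valid output
  have conclude : ∀ y q : EuclideanSpace ℝ (Fin 3), ‖r y‖ ^ 2 ≤ 289 → 0 ≤ ⟪y - a, z⟫_ℝ → y 2 < h + R₀ + 2 →
      dist y q ≤ 1 → ‖r q‖ ≤ 20 ∧ a 2 - 21 ≤ q 2 ∧ q 2 < h + R₀ + 4 := by
    intro y q hry hys hy2 hd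
    have hr17 : ‖r y‖ ≤ 17 := (sq_le_sq₀ (norm_nonneg _) (by norm_num)).1 (by linarith)
    have hcoord := abs_apply_sub_le_dist q y 2
    rw [dist_comm] at hcoord
    obtain ⟨hc1, hc2⟩ := abs_le.1 (hcoord.trans hd)
    -- height of `y` from below
    have hh := height y
    have hrm : |⟪r y, m⟫_ℝ| ≤ 17 := by
      have := abs_real_inner_le_norm (r y) m; rw [hm, mul_one] at this; exact this.trans hr17
    have hprod : |⟪r y, m⟫_ℝ * ⟪m, e₃⟫_ℝ| ≤ 17 * 1 := by
      rw [abs_mul]; exact mul_le_mul hrm hme₃ (abs_nonneg _) (by norm_num)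
    have hb := (abs_le.1 hprod).1
    have hs0 : 0 ≤ ⟪y - a, z⟫_ℝ * ⟪z, e₃⟫_ℝ := mul_nonneg hys hze₃pos.le
    refine ⟨?_, by linarith, by linarith⟩
    have e1 : q = y + (q - y) := by abel
    have hv : ‖q - y‖ ≤ 1 := by rw [← dist_eq_norm, dist_comm]; exact hd
    rw [e1, hr_add]
    have hperp : ‖q - y - ⟪q - y, z⟫_ℝ • z‖ ≤ 1 := by
      have h0 : ‖q - y - ⟪q - y, z⟫_ℝ • z‖ ^ 2 ≤ 1 ^ 2 := by
        rw [norm_sub_sq_real, norm_smul, hz, mul_one, real_inner_smul_right, Real.norm_eq_abs, sq_abs]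
        have hv2 : ‖q - y‖ ^ 2 ≤ 1 := by
          have := pow_le_pow_left₀ (norm_nonneg _) hv 2; simpa using this
        linarith [sq_nonneg ⟪q - y, z⟫_ℝ]
      exact (sq_le_sq₀ (norm_nonneg _) (by norm_num)).1 h0
    exact (norm_add_le _ _).trans (by linarith)
  intro k
  induction k with
  | zero =>
    intro y F b₁ b₂ b₃ hy _ _ _ _ _ _ _ _ hry hys hy2 hbud
    exfalso
    simp only [Nat.cast_zero] at hbud
    have hr17 : ‖r y‖ ≤ 17 := (sq_le_sq₀ (norm_nonneg _) (by norm_num)).1 (by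
      have : ‖r y‖ ^ 2 ≤ 289 := hry; linarith)
    have hrm : |⟪r y, m⟫_ℝ| ≤ 17 := by
      have := abs_real_inner_le_norm (r y) m; rw [hm, mul_one] at this; exact this.trans hr17
    have hprod : |⟪r y, m⟫_ℝ * ⟪m, e₃⟫_ℝ| ≤ 17 * 1 := by
      rw [abs_mul]; exact mul_le_mul hrm hme₃ (abs_nonneg _) (by norm_num)
    have hb := (abs_le.1 hprod).1
    have hh := height y
    have h1 : ⟪y - a, z⟫_ℝ * σ ≤ ⟪y - a, z⟫_ℝ * ⟪z, e₃⟫_ℝ := mul_le_mul_of_nonneg_left hσz hys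
    have hlt : ⟪y - a, z⟫_ℝ < S := by
      rw [hS, lt_div_iff₀ hσ]
      linarith
    linarith
  | succ k ih =>
    intro y F b₁ b₂ b₃ hy hF hb₁ hb₂ hb₃ hind h₁X h₂X h₃X hry hys hy2 hbud
    have hry' : ‖r y‖ ^ 2 ≤ 289 := hry
    -- the inward steering vector
    have hq : ∃ q : EuclideanSpace ℝ (Fin 3), ‖q‖ = 1 ∧ ⟪z, q⟫_ℝ = 0 ∧
        ∀ d : EuclideanSpace ℝ (Fin 3), ‖d‖ = 1 → (1 / 32 : ℝ) ≤ ⟪d, q⟫_ℝ →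
          ((16 : ℝ) ^ 2 ≤ ‖r y‖ ^ 2 → ⟪r y, d⟫_ℝ ≤ -(1 / 2)) := by
      by_cases hs : (16 : ℝ) ^ 2 ≤ ‖r y‖ ^ 2
      · have hr16 : 16 ≤ ‖r y‖ := (sq_le_sq₀ (by norm_num) (norm_nonneg _)).1 hs
        have hrpos : 0 < ‖r y‖ := by linarith
        refine ⟨(-(1 / ‖r y‖)) • r y, ?_, ?_, ?_⟩
        · rw [norm_smul, Real.norm_eq_abs, abs_neg, abs_of_pos (by positivity : (0 : ℝ) < 1 / ‖r y‖)]
          field_simp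
        · rw [real_inner_smul_right, real_inner_comm, hrz y, mul_zero]
        · intro d _ hdq _
          rw [real_inner_smul_right, real_inner_comm] at hdq
          have : (16 : ℝ) * (1 / 32) ≤ ‖r y‖ * (-(1 / ‖r y‖) * ⟪r y, d⟫_ℝ) :=
            mul_le_mul hr16 hdq (by norm_num) hrpos.le
          have e : ‖r y‖ * (-(1 / ‖r y‖) * ⟪r y, d⟫_ℝ) = -⟪r y, d⟫_ℝ := by field_simp
          rw [e] at this; linarith
      · exact ⟨m, hm, hzm, fun d _ _ hs' => absurd hs' hs⟩
    -- common continuation: a move `d` to a state with frame `G ∈ 𝓐`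
    have cont : ∀ (d : EuclideanSpace ℝ (Fin 3)) (G : EuclideanSpace ℝ (Fin 3) ≃ₗᵢ[ℝ] EuclideanSpace ℝ (Fin 3)),
        ‖d‖ = 1 → y + d ∈ X → G ∈ 𝓐 →
        (∃ a' ∈ fccSlots, ∃ b' ∈ fccSlots, ∃ c' ∈ fccSlots, LinearIndependent ℝ ![a', b', c'] ∧
          y + d + G a' ∈ X ∧ y + d + G b' ∈ X ∧ y + d + G c' ∈ X) →
        (1 / 32 : ℝ) ≤ ⟪d, z⟫_ℝ → ((16 : ℝ) ^ 2 ≤ ‖r y‖ ^ 2 → ⟪r y, d⟫_ℝ ≤ -(1 / 2)) →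
        ∃ q ∈ X, (X.filter fun y' => dist q y' = 1).card ≠ 12 ∧ ‖r q‖ ≤ 20 ∧ a 2 - 21 ≤ q 2 ∧ q 2 < h + R₀ + 4 := by
      intro d G hd1 hyd hG hst hrise hsteer
      obtain ⟨a', ha', b', hb', c', hc'', hind', h1, h2, h3⟩ := hst
      have hr' : ‖r (y + d)‖ ^ 2 ≤ 289 := by
        rw [hr_add]; exact perp_step_le hz (hrz y) hry' hd1 hsteer
      have hs' : ⟪y + d - a, z⟫_ℝ = ⟪y - a, z⟫_ℝ + ⟪d, z⟫_ℝ := by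
        rw [show y + d - a = (y - a) + d by abel, inner_add_left]
      have hys' : 0 ≤ ⟪y + d - a, z⟫_ℝ := by rw [hs']; linarith
      -- the new ball is not deep in the top window
      have hy'2 : (y + d) 2 < h + R₀ + 2 := by
        by_contra hge
        push Not at hge
        have hr20 : ‖r (y + d)‖ ≤ 20 := (sq_le_sq₀ (norm_nonneg _) (by norm_num)).1 (by linarith)
        have hlat' := hlat (y + d) hyd hr20 hge
        exact h𝓐 G hG (hT G (movedFcc_eq_of_exact_neighbours_top_sf A₂ t₂ X P₂ R₀ h ρ hR₀ hρ hX hP₂X hcell hP₂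
          G hyd hge hlat' ha' hb' hc'' hind' h1 h2 h3))
      have hbud' : (S - ⟪y + d - a, z⟫_ℝ) * 32 ≤ k := by
        rw [hs']; push_cast at hbud; linarith
      exact ih (y + d) G a' b' c' hyd hG ha' hb' hc'' hind' h1 h2 h3 hr' hys' hy'2 hbud'
    rcases walk_moves hg hc hX hy F hb₁ hb₂ hb₃ hind h₁X h₂X h₃X with ⟨q, hq, hdist, hdeg⟩ | hfcc | htwin
    · obtain ⟨h1, h2, h3⟩ := conclude y q hry' hys hy2 hdist
      exact ⟨q, hq, by omega, h1, h2, h3⟩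
    · obtain ⟨q, hq1, hq0, hqst⟩ := hq
      obtain ⟨w, hw, hwz, hwq⟩ := exists_steering_slot F hz hq1 hq0
      obtain ⟨hyw, hst⟩ := hfcc w hw
      have hw1 : ‖F w‖ = 1 := by rw [LinearIsometryEquiv.norm_map, norm_eq_one_of_mem_fccSlots hw]
      exact cont (F w) F hw1 hyw hF hst hwz (hqst _ hw1 hwq)
    · obtain ⟨nn, hn, hmenu, F', hF', hown, hmirr, hfar⟩ := htwin
      obtain ⟨hout, hin⟩ := hmir F hF nn hn hmenu F' hF'
      by_cases hF'T : F' ∈ 𝓣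
      · -- TERMINAL: refuse the mirror and slide up the plate
        have hnm := hin hF'T
        have hzn : ⟪z, nn⟫_ℝ = 0 := by
          rcases hnm with h0 | h0 <;> rw [h0]
          · exact hzm
          · rw [inner_neg_right, hzm, neg_zero]
        have he₃' : e₃ = ⟪e₃, z⟫_ℝ • z + ⟪e₃, nn⟫_ℝ • nn := by
          rcases hnm with h0 | h0 <;> rw [h0]
          · exact he₃
          · rw [inner_neg_right, smul_neg, neg_smul, neg_neg]; exact he₃
        have hGne : F '' fccStacking 1 (Real.sqrt (2 / 3)) ≠ A₂ '' fccStacking 1 (Real.sqrt (2 / 3)) :=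
          fun hEq => h𝓐 F hF (hT F hEq)
        obtain ⟨q, hq, hdeg, hrq, hq1, hq2⟩ := twinDozen_plateSlide_payer hg hc A₂ t₂ X P₂ R₀ h ρ hR₀ hρ hX hP₂X
          hcell hP₂ F hGne hn hmenu hz hzn hσ hσz he₃' a hlat hy hy2 hys hry'
          (fun w hw hle => (hown w hw hle).1) hfar
        exact ⟨q, hq, hdeg, hrq, hq1, hq2⟩
      · have hF'𝓐 : F' ∈ 𝓐 := hout hF'T
        obtain ⟨q, hq1, hq0, hqst⟩ := hq
        rcases exists_steering_twinDozen F hn hz hq1 hq0 hmenu with ⟨w, hw, hle, hwz, hwq⟩ | ⟨w, hw, hlt, hwz, hwq⟩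
        · obtain ⟨hyw, hst⟩ := hown w hw hle
          have hw1 : ‖F w‖ = 1 := by rw [LinearIsometryEquiv.norm_map, norm_eq_one_of_mem_fccSlots hw]
          exact cont (F w) F hw1 hyw hF hst hwz (hqst _ hw1 hwq)
        · obtain ⟨hyw, hst⟩ := hmirr w hw hlt
          have hw1 : ‖F' w‖ = 1 := by rw [LinearIsometryEquiv.norm_map, norm_eq_one_of_mem_fccSlots hw]
          have e : F w - (2 * ⟪F w, nn⟫_ℝ) • nn = F' w := (hF' w).symm
          rw [e] at hwz hwq
          exact cont (F' w) F' hw1 hyw hF'𝓐 hst hwz (hqst _ hw1 hwq)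

end Summit.Ventures.Crystal3D.Theorems

end
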